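import Summits.Ventures.LatticeQCDFlow.Scoring.ChainTauIntWindowCLT
import Summits.Ventures.LatticeQCDFlow.Scoring.MeanSubtractedAcovCLT
import Summits.Ventures.LatticeQCDFlow.Exactness.NCMCGeneralSpaceLagProductMoments
import Summits.Ventures.LatticeQCDFlow.Scoring.SampleACFSumZero

/-!
# WHAT THE SCORER PRINTS, ON CHAIN DATA: the fixed-window CLT for scorer A's `tauIntWindow (rhoHat y N) W`
# (centred by the sample mean, `1/(N−t)`-normalised) along a chain with a Doeblin power, from EVERY
# initial law — mean subtraction and `1/(N−t)` are `o_p(N^{-1/2})` along the chain too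

HONEST FRAMING: exact (Metropolis-corrected) sampling algorithms for lattice gauge theory;
figures of merit are autocorrelation/cost numbers at stated couplings and volumes; no
continuum-physics claim.

Venture `LatticeQCDFlow` (cell pub-lqcd), sub-topic `Scoring`; FANOUT row 16 (`su2-base`), GEN-9.
NEW WORK of the cell, not a published result; no definition; nothing is cited as a fact.  DOCKING of
GEN-9's known-mean joint CLT for chain data (`Scoring/ChainLagProductCLT`) with GEN-8's ABSTRACT
mean-subtraction lemma (`Scoring/MeanSubtractionCLT.tendstoInMeasure_sqrt_mul_acovHatC_sub_acovHat`:
`√N (Γ̂_c(t)[X] − Γ̂(t)[X − μ]) → 0` in measure as soon as `√N x̄_N` is tight and shifted sample means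
vanish) and the coordinatewise-null tool of `Scoring/MeanSubtractedAcovCLT`.  The two inputs of the
abstract lemma along a chain with a Doeblin power, from any initial law: `√N · (sample mean of f̄)` is
tight by row 13's any-start CLT (`NCMCGeneralSpaceDoeblinPowerCLT`), and the shifted sample means
`(1/N) Σ_{i<N} f̄(X_{i+t}) → 0` in measure by row 13's any-start second-moment bound
(`NCMCGeneralSpaceLagProductMoments.chain_sq_sum_centred_le_of_nHit`).  The statistic is then literally
scorer A's: `acovHatC (f ∘ X) N t = gammaHat (i ↦ f(x_i)) N t` (`acovHatC_chain_eq_gammaHat`, by `rfl`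
up to unfolding), so the conclusion is stated for `tauIntWindow (rhoHat (i ↦ f(x_i)) N) W` — the exact
quantity whose consistency at fixed `W` is GEN-8's `ChainMadrasSokalDataWindow` and whose NOT-CLAIMED
line ('the fixed-window law of `τ̂_W` for chains') this closes.

## Content (`κ` Markov, `π` invariant, `(nHit κ m)(z,·) ≥ ε ν` for all `z`, `ε ≠ 0`, `0 < m`; `|f| ≤ C`
## measurable, `f̄ = f − ∫ f dπ`, `C(t) = autocov κ π f̄ t`; `μ₀` ANY initial law)

* `tendstoInMeasure_chain_shiftedMean_of_nHit` — `(1/N) Σ_{i<N} f̄(X_{i+t}) → 0` in `P_{μ₀}`-measure;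
* `tendstoInDistribution_chain_sqrt_mul_mean_of_nHit` — `√N · (sample mean of f̄) ⇒ N(0, σ²_f)` (row 13's
  CLT in the `seqMean` form);
* **`tendstoInDistribution_chain_acovHatC_of_nHit`** — the joint CLT for the CENTRED `1/(N−t)` vector
  `(acovHatC (f ∘ X) N t)_{t≤W}` with the SAME limit `Z` as the known-mean statistic;
* `acovHatC_chain_eq_gammaHat` — it is scorer A's `gammaHat`;
* **`tendstoInDistribution_chain_scorer_tauIntWindow_of_nHit`** — THE THEOREM: `C(0) ≠ 0`; for every
  `Z` with `⟪a, Z⟫ ∼ N(0, windowLRVar κ π W (lagProdComb f̄ W a))` and EVERY `μ₀`: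
  `√N (tauIntWindow (rhoHat (i ↦ f(x_i)) N) W − tauIntWindow (C(·)/C(0)) W) ⇒ ⟪tauHatGrad W (C(t))_t, Z⟫`;
  `…_of_minorised` — the one-step Doeblin case `κ(z,·) ≥ ε ν` (row 8's hypothesis shape).

NOT CLAIMED: data-chosen windows (GEN-8's transfer `MadrasSokalDataWindow.tendstoInDistribution_at_msWindow`
+ `ChainMadrasSokalDataWindow` now have every input — docking left to the next file); studentisation;
rates.
-/

noncomputable section

open MeasureTheory ProbabilityTheory Filter Finset Preorder WithLp Literature.Probability.MarkovChains
open scoped ENNReal Topology RealInnerProductSpace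
open Summit.Ventures.LatticeQCDFlow.Exactness Summit.Ventures.LatticeQCDFlow.Exactness.GeneralNCMC

namespace Summit.Ventures.LatticeQCDFlow.Scoring

variable {S : Type*} [MeasurableSpace S]

section Scorer

variable (κ : Kernel S S) [IsMarkovKernel κ] {π : Measure S} [IsProbabilityMeasure π]
  {ν : Measure S} [IsProbabilityMeasure ν] {ε : ℝ≥0∞} {m : ℕ}

/-! ## The two inputs of the abstract mean-subtraction lemma, along the chain -/

/-- **Shifted sample means of `f̄` vanish in `P_{μ₀}`-measure**: `(1/N) Σ_{i<N} f̄(X_{i+t}) → 0`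
(second moment `≤ K N` from any start, Jensen, Markov). -/
theorem tendstoInMeasure_chain_shiftedMean_of_nHit (hπ : Kernel.Invariant κ π) (hε : ε ≠ 0)
    (hmin : ∀ z, ε • ν ≤ nHit κ m z) (hm : 0 < m) {f : S → ℝ} (hf : Measurable f) {C : ℝ}
    (hC : ∀ z, |f z| ≤ C) (μ₀ : Measure S) [IsProbabilityMeasure μ₀] (t : ℕ) :
    TendstoInMeasure (Kernel.trajMeasure (X := fun _ : ℕ => S) μ₀
        (fun n : ℕ => κ.comap (fun hh : (i : ↥(Finset.Iic n)) → S => hh ⟨n, Finset.mem_Iic.2 le_rfl⟩)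
          (measurable_pi_apply _)))
      (fun (N : ℕ) (x : ℕ → S) => (∑ i ∈ range N, (f (x (i + t)) - ∫ z', f z' ∂π)) / N)
      atTop (fun _ => 0) := by
  set P := Kernel.trajMeasure (X := fun _ : ℕ => S) μ₀
    (fun n : ℕ => κ.comap (fun hh : (i : ↥(Finset.Iic n)) → S => hh ⟨n, Finset.mem_Iic.2 le_rfl⟩)
      (measurable_pi_apply _)) with hP
  haveI := isMarkovKernel_nHit κ m
  haveI : Nonempty S := nonempty_of_isProbabilityMeasure π
  have hε0 : 0 < ε := pos_iff_ne_zero.2 hε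
  have hε1 : ε ≤ 1 := eps_le_one_of_minorised hmin
  have hminS : ∀ x {B : Set S}, MeasurableSet B → ε * ν B ≤ nHit κ m x B :=
    fun x _ hB => minorised_setwise hmin x hB
  obtain ⟨hfbm, hfbC, -⟩ := centred_observable_bounds π hf hC
  set K : ℝ := (2 * C) ^ 2 * (2 + 4 * m / ε.toReal) with hK
  -- the statistic, its measurability and bound
  set R : ℕ → (ℕ → S) → ℝ := fun N x => (∑ i ∈ range N, (f (x (i + t)) - ∫ z', f z' ∂π)) / N with hR
  have hSm : ∀ N, Measurable fun x : ℕ → S => ∑ i ∈ range N, (f (x (i + t)) - ∫ z', f z' ∂π) :=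
    fun N => Finset.measurable_sum _ fun i _ => hfbm.comp (measurable_pi_apply _)
  have hRm : ∀ N, Measurable (R N) := fun N => (hSm N).div_const _
  have hRb : ∀ N x, |R N x| ≤ 2 * C := fun N x => by
    simp only [hR]
    rcases Nat.eq_zero_or_pos N with hN | hN
    · subst hN
      simp only [sum_range_zero, Nat.cast_zero, div_zero, abs_zero]
      exact (abs_nonneg _).trans (hfbC (x 0))
    · rw [abs_div, Nat.abs_cast, div_le_iff₀ (Nat.cast_pos.2 hN)]
      calc |∑ i ∈ range N, (f (x (i + t)) - ∫ z', f z' ∂π)|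
          ≤ ∑ i ∈ range N, |f (x (i + t)) - ∫ z', f z' ∂π| := abs_sum_le_sum_abs _ _
        _ ≤ ∑ _i ∈ range N, 2 * C := sum_le_sum fun i _ => hfbC _
        _ = 2 * C * N := by rw [sum_const, card_range, nsmul_eq_mul, mul_comm]
  -- second moment: `E R_N² ≤ K / N`
  have hsq : ∀ N, ∫ x, R N x ^ 2 ∂P ≤ K / N := fun N => by
    rcases Nat.eq_zero_or_pos N with hN | hN
    · subst hN
      simp [hR]
    · have hNR : (0 : ℝ) < N := Nat.cast_pos.2 hN
      have hmom := chain_sq_sum_centred_le_of_nHit (μ₀ := μ₀) hminS hε0 hε1 hm hπ hf hC t N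
      rw [← hP] at hmom
      have hcomm : ∀ x : ℕ → S, (∑ i ∈ range N, (f (x (i + t)) - ∫ z', f z' ∂π))
          = ∑ i ∈ range N, (f (x (t + i)) - ∫ z', f z' ∂π) := fun x =>
        sum_congr rfl fun i _ => by rw [Nat.add_comm]
      have hRsq : ∀ x, R N x ^ 2 = (N : ℝ)⁻¹ ^ 2 * (∑ i ∈ range N, (f (x (t + i)) - ∫ z', f z' ∂π)) ^ 2 :=
        fun x => by simp only [hR, hcomm x, div_eq_mul_inv]; ring
      simp_rw [hRsq]
      rw [integral_const_mul]
      calc (N : ℝ)⁻¹ ^ 2 * ∫ x, (∑ i ∈ range N, (f (x (t + i)) - ∫ z', f z' ∂π)) ^ 2 ∂P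
          ≤ (N : ℝ)⁻¹ ^ 2 * (K * N) := mul_le_mul_of_nonneg_left hmom (sq_nonneg _)
        _ = K / N := by field_simp
  -- first moment by Jensen, then Markov
  refine tendstoInMeasure_zero_of_integral_abs_le (b := fun N => Real.sqrt (K / N))
    (fun N => integrable_of_bounded _ (hRm N) (hRb N)) (fun N => ?_) ?_
  · have hJ := sq_integral_le_integral_sq P (hRm N).abs (C := 2 * C) (fun x => by
      rw [abs_abs]; exact hRb N x)
    simp only [sq_abs] at hJ
    calc ∫ x, |R N x| ∂P = Real.sqrt ((∫ x, |R N x| ∂P) ^ 2) :=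
          (Real.sqrt_sq (integral_nonneg fun x => abs_nonneg _)).symm
      _ ≤ Real.sqrt (K / N) := Real.sqrt_le_sqrt (hJ.trans (hsq N))
  · have h := (tendsto_const_div_atTop_nhds_zero_nat K).sqrt
    rwa [Real.sqrt_zero] at h

/-- **`√N · (sample mean of f̄) ⇒ N(0, σ²_f)` from every initial law** — row 13's any-start CLT in the
`seqMean` form used by the abstract mean-subtraction lemma, with the concrete limit `id` on
`(ℝ, N(0, σ²_f))`. -/
theorem tendstoInDistribution_chain_sqrt_mul_mean_of_nHit (hπ : Kernel.Invariant κ π) (hε : ε ≠ 0)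
    (hmin : ∀ z, ε • ν ≤ nHit κ m z) (hm : 0 < m) {f : S → ℝ} (hf : Measurable f) {C : ℝ}
    (hC : ∀ z, |f z| ≤ C) (μ₀ : Measure S) [IsProbabilityMeasure μ₀]
    [IsProbabilityMeasure (Kernel.trajMeasure (X := fun _ : ℕ => S) μ₀
        (fun n : ℕ => κ.comap (fun hh : (i : ↥(Finset.Iic n)) → S => hh ⟨n, Finset.mem_Iic.2 le_rfl⟩)
          (measurable_pi_apply _)))] :
    TendstoInDistribution
      (fun (N : ℕ) (x : ℕ → S) => Real.sqrt N
        * seqMean N (fun (i : ℕ) (x : ℕ → S) => f (x i) - ∫ z', f z' ∂π) x)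
      atTop (id : ℝ → ℝ)
      (fun _ => Kernel.trajMeasure (X := fun _ : ℕ => S) μ₀
        (fun n : ℕ => κ.comap (fun hh : (i : ↥(Finset.Iic n)) → S => hh ⟨n, Finset.mem_Iic.2 le_rfl⟩)
          (measurable_pi_apply _)))
      (gaussianReal 0 (Real.toNNReal ((∫ y, (f y - ∫ z, f z ∂π) ^ 2 ∂π)
        + 2 * ∑' k, ∫ y, (f y - ∫ z, f z ∂π)
          * (kop κ)^[k + 1] (fun y => f y - ∫ z, f z ∂π) y ∂π))) := by
  have h := tendstoInDistribution_timeAverage_of_nHit hπ hε hmin hm hf hC μ₀ (Y := id)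
    (P' := gaussianReal 0 (Real.toNNReal ((∫ y, (f y - ∫ z, f z ∂π) ^ 2 ∂π)
      + 2 * ∑' k, ∫ y, (f y - ∫ z, f z ∂π) * (kop κ)^[k + 1] (fun y => f y - ∫ z, f z ∂π) y ∂π)))
    HasLaw.id
  refine h.congr (fun N => Eventually.of_forall fun x => ?_) EventuallyEq.rfl
  simp only [seqMean]
  rw [mul_div_left_comm, Real.sqrt_div_self, mul_comm]

/-! ## The joint CLT for the scorers' centred, `1/(N−t)`-normalised autocovariances on chain data -/

/-- **THE JOINT CLT FOR `(acovHatC (f ∘ X) N t)_{t≤W}` ALONG A CHAIN WITH A DOEBLIN POWER, FROM ANY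
INITIAL LAW** — same centring `(C(t))_t` and same limit `Z` as the known-mean statistic of
`ChainLagProductCLT`: mean subtraction and `1/(N−t)` do not change the limit law. -/
theorem tendstoInDistribution_chain_acovHatC_of_nHit (hπ : Kernel.Invariant κ π) (hε : ε ≠ 0)
    (hmin : ∀ z, ε • ν ≤ nHit κ m z) (hm : 0 < m)
    {f : S → ℝ} (hf : Measurable f) {C : ℝ} (hC : ∀ z, |f z| ≤ C) (W : ℕ)
    (μ₀ : Measure S) [IsProbabilityMeasure μ₀]
    {Ω' : Type*} [MeasurableSpace Ω'] {P' : Measure Ω'} [IsProbabilityMeasure P']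
    {Z : Ω' → EuclideanSpace ℝ (Fin (W + 1))} (hZm : AEMeasurable Z P')
    (hZ : ∀ a : EuclideanSpace ℝ (Fin (W + 1)), HasLaw (fun ω' => ⟪a, Z ω'⟫)
      (gaussianReal 0 (windowLRVar κ π W (lagProdComb (fun z => f z - ∫ z', f z' ∂π) W a)).toNNReal) P')
    [IsProbabilityMeasure (Kernel.trajMeasure (X := fun _ : ℕ => S) μ₀
        (fun n : ℕ => κ.comap (fun hh : (i : ↥(Finset.Iic n)) → S => hh ⟨n, Finset.mem_Iic.2 le_rfl⟩)
          (measurable_pi_apply _)))] :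
    TendstoInDistribution
      (fun (N : ℕ) (x : ℕ → S) => Real.sqrt N
        • (toLp 2 (fun t : Fin (W + 1) => acovHatC (fun (i : ℕ) (x : ℕ → S) => f (x i)) N t x)
          - toLp 2 (fun t : Fin (W + 1) => autocov κ π (fun z => f z - ∫ z', f z' ∂π) t)))
      atTop Z (fun _ => Kernel.trajMeasure (X := fun _ : ℕ => S) μ₀
        (fun n : ℕ => κ.comap (fun hh : (i : ↥(Finset.Iic n)) → S => hh ⟨n, Finset.mem_Iic.2 le_rfl⟩)
          (measurable_pi_apply _))) P' := by
  set P := Kernel.trajMeasure (X := fun _ : ℕ => S) μ₀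
    (fun n : ℕ => κ.comap (fun hh : (i : ↥(Finset.Iic n)) → S => hh ⟨n, Finset.mem_Iic.2 le_rfl⟩)
      (measurable_pi_apply _)) with hP
  obtain ⟨hfbm, hfbC, -⟩ := centred_observable_bounds π hf hC
  set X : ℕ → (ℕ → S) → ℝ := fun i x => f (x i) with hX
  set Y : ℕ → (ℕ → S) → ℝ := fun i x => f (x i) - ∫ z', f z' ∂π with hY
  have hXY : ∀ i x, X i x = Y i x + ∫ z', f z' ∂π := fun i x => (sub_add_cancel _ _).symm
  have hYm : ∀ i, Measurable (Y i) := fun i => hfbm.comp (measurable_pi_apply i)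
  have hXm : ∀ i, Measurable (X i) := fun i => hf.comp (measurable_pi_apply i)
  -- the known-mean CLT
  have hclt := tendstoInDistribution_chain_acovHat_of_nHit κ hπ hε hmin hm hf hC W μ₀ hZm hZ
  -- the difference `→ 0` coordinate by coordinate (GEN-8's abstract lemma)
  have hdiff : TendstoInMeasure P (fun (N : ℕ) x => Real.sqrt N
      • (toLp 2 (fun t : Fin (W + 1) => acovHatC X N t x)
        - toLp 2 (fun t : Fin (W + 1) => acovHat Y N t x))) atTop fun _ => 0 := by
    refine tendstoInMeasure_euclidean_zero fun t => ?_
    have hint : ∀ i, Integrable (fun x => Y i x * Y (i + t) x) P := fun i =>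
      integrable_of_bounded _ ((hYm i).mul (hYm _)) (C := 2 * C * (2 * C)) fun x => by
        rw [abs_mul]
        exact mul_le_mul (hfbC _) (hfbC _) (abs_nonneg _) ((abs_nonneg _).trans (hfbC (x i)))
    have hM : ∀ i, ∫ x, |Y i x * Y (i + t) x| ∂P ≤ 2 * C * (2 * C) := fun i => by
      have h := norm_integral_le_of_norm_le_const (μ := P) (f := fun x => |Y i x * Y (i + t) x|)
        (C := 2 * C * (2 * C)) (Eventually.of_forall fun x => by
          rw [Real.norm_eq_abs, abs_abs, abs_mul]
          exact mul_le_mul (hfbC _) (hfbC _) (abs_nonneg _) ((abs_nonneg _).trans (hfbC (x i))))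
      rw [Real.norm_eq_abs, probReal_univ, mul_one] at h
      exact le_of_abs_le h
    have hmean := tendstoInDistribution_chain_sqrt_mul_mean_of_nHit κ hπ hε hmin hm hf hC μ₀
    have hshift := tendstoInMeasure_chain_shiftedMean_of_nHit κ hπ hε hmin hm hf hC μ₀ (t : ℕ)
    have h := tendstoInMeasure_sqrt_mul_acovHatC_sub_acovHat (P := P) (t := (t : ℕ)) hXY hYm hint hM
      hmean hshift
    refine h.congr (fun N => Eventually.of_forall fun x => ?_) EventuallyEq.rfl
    simp only [WithLp.ofLp_smul, WithLp.ofLp_sub, Pi.smul_apply, Pi.sub_apply, smul_eq_mul]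
  have hmeas : ∀ N : ℕ, AEMeasurable (fun x : ℕ → S => Real.sqrt N
      • (toLp 2 (fun t : Fin (W + 1) => acovHatC X N t x)
        - toLp 2 (fun t : Fin (W + 1) => autocov κ π (fun z => f z - ∫ z', f z' ∂π) t))) P :=
    fun N => by
    have hv : Measurable fun x : ℕ → S => toLp 2 (fun t : Fin (W + 1) => acovHatC X N t x) :=
      (WithLp.measurable_toLp 2 _).comp (measurable_pi_lambda _ fun t : Fin (W + 1) =>
        measurable_acovHatC hXm N t)
    exact ((hv.sub_const _).const_smul (Real.sqrt (N : ℝ))).aemeasurable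
  refine tendstoInDistribution_of_tendstoInMeasure_sub _ _ hclt ?_ hmeas
  refine hdiff.congr (fun N => Eventually.of_forall fun x => ?_) EventuallyEq.rfl
  simp only [Pi.sub_apply, smul_sub]
  abel

/-! ## The scorer's statistic, and the theorem -/

omit [MeasurableSpace S] in
/-- **The centred `1/(N−t)` estimator read along the path IS scorer A's `gammaHat`**:
`acovHatC (i ↦ f(x_i)) N t x = gammaHat (i ↦ f(x_i)) N t` (unfolding both definitions). -/
theorem acovHatC_chain_eq_gammaHat (f : S → ℝ) (N t : ℕ) (x : ℕ → S) :
    acovHatC (fun (i : ℕ) (x : ℕ → S) => f (x i)) N t x = gammaHat (fun i => f (x i)) N t := by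
  simp only [acovHatC, seqMean, gammaHat, acovSum, lagSum, dev, sampleMean]

/-- **THE FIXED-WINDOW CLT FOR WHAT SCORER A PRINTS ON CHAIN DATA, FROM ANY INITIAL LAW.**  `κ` Markov
with invariant probability `π`, `(nHit κ m)(z, ·) ≥ ε ν` for all `z` (`ε ≠ 0`, `0 < m`); `|f| ≤ C`
measurable, `f̄ = f − ∫ f dπ`, `C(t) = autocov κ π f̄ t`, `C(0) ≠ 0`; `Z` a random vector of `ℝ^{W+1}`
with `⟪a, Z⟫ ∼ N(0, windowLRVar κ π W (lagProdComb f̄ W a))` for all `a`; `ℓ = tauHatGrad W (C(t))_t`.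
For EVERY initial law `μ₀`, under `P_{μ₀}`:
`√N (tauIntWindow (rhoHat (i ↦ f(x_i)) N) W − tauIntWindow (C(·)/C(0)) W) ⇒ ⟪ℓ, Z⟫`. -/
theorem tendstoInDistribution_chain_scorer_tauIntWindow_of_nHit (hπ : Kernel.Invariant κ π)
    (hε : ε ≠ 0) (hmin : ∀ z, ε • ν ≤ nHit κ m z) (hm : 0 < m)
    {f : S → ℝ} (hf : Measurable f) {C : ℝ} (hC : ∀ z, |f z| ≤ C) (W : ℕ)
    (hσ : autocov κ π (fun z => f z - ∫ z', f z' ∂π) 0 ≠ 0)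
    (μ₀ : Measure S) [IsProbabilityMeasure μ₀]
    {Ω' : Type*} [MeasurableSpace Ω'] {P' : Measure Ω'} [IsProbabilityMeasure P']
    {Z : Ω' → EuclideanSpace ℝ (Fin (W + 1))} (hZm : AEMeasurable Z P')
    (hZ : ∀ a : EuclideanSpace ℝ (Fin (W + 1)), HasLaw (fun ω' => ⟪a, Z ω'⟫)
      (gaussianReal 0 (windowLRVar κ π W (lagProdComb (fun z => f z - ∫ z', f z' ∂π) W a)).toNNReal) P')
    [IsProbabilityMeasure (Kernel.trajMeasure (X := fun _ : ℕ => S) μ₀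
        (fun n : ℕ => κ.comap (fun hh : (i : ↥(Finset.Iic n)) → S => hh ⟨n, Finset.mem_Iic.2 le_rfl⟩)
          (measurable_pi_apply _)))] :
    TendstoInDistribution
      (fun (N : ℕ) (x : ℕ → S) => Real.sqrt N
        * (tauIntWindow (rhoHat (fun i => f (x i)) N) W
          - tauIntWindow (fun t => autocov κ π (fun z => f z - ∫ z', f z' ∂π) t
              / autocov κ π (fun z => f z - ∫ z', f z' ∂π) 0) W))
      atTop (fun ω' => ⟪tauHatGrad W (toLp 2 fun t : Fin (W + 1) =>
        autocov κ π (fun z => f z - ∫ z', f z' ∂π) t), Z ω'⟫)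
      (fun _ => Kernel.trajMeasure (X := fun _ : ℕ => S) μ₀
        (fun n : ℕ => κ.comap (fun hh : (i : ↥(Finset.Iic n)) → S => hh ⟨n, Finset.mem_Iic.2 le_rfl⟩)
          (measurable_pi_apply _))) P' := by
  set P := Kernel.trajMeasure (X := fun _ : ℕ => S) μ₀
    (fun n : ℕ => κ.comap (fun hh : (i : ↥(Finset.Iic n)) → S => hh ⟨n, Finset.mem_Iic.2 le_rfl⟩)
      (measurable_pi_apply _)) with hP
  set fb : S → ℝ := fun z => f z - ∫ z', f z' ∂π with hfb
  set cvec : EuclideanSpace ℝ (Fin (W + 1)) := toLp 2 fun t : Fin (W + 1) => autocov κ π fb t with hcvec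
  set T : ℕ → (ℕ → S) → EuclideanSpace ℝ (Fin (W + 1)) :=
    fun N x => toLp 2 fun t : Fin (W + 1) => acovHatC (fun (i : ℕ) (x : ℕ → S) => f (x i)) N t x with hT
  have hclt : TendstoInDistribution (fun (N : ℕ) x => Real.sqrt N • (T N x - cvec)) atTop Z
      (fun _ => P) P' :=
    tendstoInDistribution_chain_acovHatC_of_nHit κ hπ hε hmin hm hf hC W μ₀ hZm hZ
  have hXm : ∀ i : ℕ, Measurable fun x : ℕ → S => f (x i) := fun i => hf.comp (measurable_pi_apply i)
  have hTm : ∀ N, AEMeasurable (T N) P := fun N => by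
    have h : Measurable (T N) :=
      (WithLp.measurable_toLp 2 _).comp (measurable_pi_lambda _ fun t => measurable_acovHatC hXm N t)
    exact h.aemeasurable
  have hc0 : cvec 0 ≠ 0 := hσ
  have hD := CardConsistency.tendstoInDistribution_deltaMethod_fderiv
    (a := fun N : ℕ => Real.sqrt N) (Real.tendsto_sqrt_atTop.comp tendsto_natCast_atTop_atTop)
    hclt hTm (hasFDerivAt_tauHatFn cvec hc0) (measurable_tauHatFn W)
  refine hD.congr (fun N => Eventually.of_forall fun x => ?_) (Eventually.of_forall fun ω' => ?_)
  · rw [smul_eq_mul, hT, hcvec,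
      tauHatFn_toLp (fun t => acovHatC (fun (i : ℕ) (x : ℕ → S) => f (x i)) N t x),
      tauHatFn_toLp (fun t => autocov κ π fb t)]
    simp only [acovHatC_chain_eq_gammaHat]
    rfl
  · exact tauHatDeriv_apply cvec (Z ω')

/-- **The one-step Doeblin case** (`κ(z, ·) ≥ ε ν` for all `z`, row 8's hypothesis shape; `m = 1`). -/
theorem tendstoInDistribution_chain_scorer_tauIntWindow_of_minorised (hπ : Kernel.Invariant κ π)
    (hε : ε ≠ 0) (hmin : ∀ z, ε • ν ≤ κ z)
    {f : S → ℝ} (hf : Measurable f) {C : ℝ} (hC : ∀ z, |f z| ≤ C) (W : ℕ)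
    (hσ : autocov κ π (fun z => f z - ∫ z', f z' ∂π) 0 ≠ 0)
    (μ₀ : Measure S) [IsProbabilityMeasure μ₀]
    {Ω' : Type*} [MeasurableSpace Ω'] {P' : Measure Ω'} [IsProbabilityMeasure P']
    {Z : Ω' → EuclideanSpace ℝ (Fin (W + 1))} (hZm : AEMeasurable Z P')
    (hZ : ∀ a : EuclideanSpace ℝ (Fin (W + 1)), HasLaw (fun ω' => ⟪a, Z ω'⟫)
      (gaussianReal 0 (windowLRVar κ π W (lagProdComb (fun z => f z - ∫ z', f z' ∂π) W a)).toNNReal) P')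
    [IsProbabilityMeasure (Kernel.trajMeasure (X := fun _ : ℕ => S) μ₀
        (fun n : ℕ => κ.comap (fun hh : (i : ↥(Finset.Iic n)) → S => hh ⟨n, Finset.mem_Iic.2 le_rfl⟩)
          (measurable_pi_apply _)))] :
    TendstoInDistribution
      (fun (N : ℕ) (x : ℕ → S) => Real.sqrt N
        * (tauIntWindow (rhoHat (fun i => f (x i)) N) W
          - tauIntWindow (fun t => autocov κ π (fun z => f z - ∫ z', f z' ∂π) t
              / autocov κ π (fun z => f z - ∫ z', f z' ∂π) 0) W))
      atTop (fun ω' => ⟪tauHatGrad W (toLp 2 fun t : Fin (W + 1) =>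
        autocov κ π (fun z => f z - ∫ z', f z' ∂π) t), Z ω'⟫)
      (fun _ => Kernel.trajMeasure (X := fun _ : ℕ => S) μ₀
        (fun n : ℕ => κ.comap (fun hh : (i : ↥(Finset.Iic n)) → S => hh ⟨n, Finset.mem_Iic.2 le_rfl⟩)
          (measurable_pi_apply _))) P' :=
  tendstoInDistribution_chain_scorer_tauIntWindow_of_nHit κ hπ hε (m := 1)
    (fun z => by rw [nHit_one]; exact hmin z) Nat.one_pos hf hC W hσ μ₀ hZm hZ

end Scorer

end Summit.Ventures.LatticeQCDFlow.Scoring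

end
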